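import Summits.QuantumFields.BalabanUV.T4Continuum.Support.NE7EtaBackgroundEnergyClass
import Summits.QuantumFields.BalabanUV.T4Continuum.Support.NE7FluxGradientFromTension

/-!
# NE7EtaBackgroundTensionClass — (H∃)ᴱ REDUCED TO TENSION DECAY: the energy-class hypothesis of route 1's docked END
# (`NE7Route1EndDockedEnergy`, p325008) follows from an `ℓ²` bound on the YANG–MILLS TENSION of one constrained minimiser per level
# (step (E1) of the energy road docked into `NE7EtaBackgroundEnergyClass`)

Cell `pub-balaban`, rung (B)+1 sub-cell t4, lineage `b2b-balaban-t4-ne7-p1`, generation 62 (CRUX PROVER NE7 #1, ruling e34b3e0c (2)); hunt (h7)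
«ENERGY ROAD» (`t4/b2b-balaban-t4-ne7-p1-g61/HUNT-H7-ENERGY-ROAD.md`).  Gen 61 lowered row NE3's (H∃) to the energy class
(H∃)ᴱ `∀ V ∈ dom, ∀ k, ∃ U, IsMinimiser d (sfClass d L N ε) L N k V U ∧ Regular d L N ε g k U`, i.e. ONE inequality per level
`gradFluxSq U (periodBox (N·L^k)) ≤ g·N^d·(L^k)^d∕(L^k)⁶` (`NE7EtaBackgroundEnergyClass.hminE_of_gradFluxSq`).  Gen 62's step (E1)
(`NE7FluxGradientFromTension.gradFluxSq_le_tension_sfClass`: the flux-gradient energy is `card n ×` the tension energy `+ 220·card n·d³·ε³ ×` the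
scale factor) turns this into a statement about the TENSION alone:

* **`regular_of_tension`**: a configuration of `sfClass d L N ε k` (`L ≥ 1`, `N ≥ 1`, `0 ≤ ε ≤ 1∕50`) whose flux form `B` has tension energy
  `Σ_{x ∈ periodBox (N·L^k)} Σ_ν nhsNormSq (Σ_μ ∇_μ^† B_{μν}(x)) ≤ g′·N^d·(L^k)^d∕(L^k)⁶` is `Regular d L N ε (card n·g′ + 220·card n·d³·ε³) k`;
* **`hminE_of_tension`**: hence (H∃)ᴱ with `g = card n·g′ + 220·card n·d³·ε³` follows from (H∃)ᵀ — «for every datum of `dom` and every level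
  SOME minimiser has tension energy `≤ g′·N^d·(L^k)^d∕(L^k)⁶`» — and **`hminE_of_tension_apriori`**: from non-emptiness of the admissible sets
  plus the universal a-priori tension bound (existence by compactness, `NE7EtaBackgroundEnergyClass.hminE_of_apriori`'s regime).
So the (A)-bill of route 1 at data with curvature now reads X-A4 ∧ (H∃)ᵀ; (H∃)ᵀ is steps (E2) (criticality of the constrained minimiser along
the kernel of the linearised `k`-fold average), (E3) (the multiplier bound) and the interiority (8) of the memo — NOT proved here.
HONEST FRAMING (page 1): FIXED FINITE T⁴∕torus, rung (B)+1; bookkeeping over kernel theorems; (H∃)ᵀ asserted for no configuration; NE7, NE3 NOT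
PRINTED in [Balaban1984PropagatorsI]–[Balaban1989LargeFieldII] and NOT PROVED; continuum YM on T⁴ ⇐ BetaPertH ∧ nine spine estimates (0/9 proved);
BetaPertH ⇐ (D1) ∧ (D4) ∧ CAP+tail; G-an2-4 gates asym, D1 and NE2/3/4; NOT infinite volume, NOT mass gap, NOT Clay.  0 def, 0 sorry.
-/

set_option autoImplicit false

open scoped BigOperators Matrix Matrix.Norms.L2Operator
open NormedSpace Finset

namespace Summit.QuantumFields.BalabanUV.T4Continuum.NE7EtaBackgroundTensionClass

open Literature.MathematicalPhysics.QuantumFieldTheory.Balaban1983to89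
open B7Prop1Explicit B7Prop2Explicit MatrixNorms
open T4AveragingDeficitWall hiding Site Plane Plaq Bond
open T4AveragingDeficitWallBoundary (periodBox IsPeriodicCfg)
open MinimalActionSandwich (IsMinimiser admissible)
open MinimalActionRate (Regular sfClass)
open MinimalActionExistence (exists_isMinimiser_of_nonempty)
open NE3CovariantCalculus (cDstar)
open NE7EtaBackgroundEnergyClass (regular_of_mem_sfClass hminE_of_gradFluxSq)
open NE7FluxGradientFromTension (gradFluxSq_le_tension_sfClass exists_fluxForm)

noncomputable section

variable {d : ℕ} {n : Type*} [Fintype n] [DecidableEq n] [Nonempty n]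

/-- **TENSION DECAY ⇒ THE ENERGY CLASS.**  For `U ∈ sfClass d L N ε k` (`L, N ≥ 1`, `0 ≤ ε ≤ 1∕50`) with flux form `B` (`B(x;μ,ν) = F(x;μ<ν)`,
`B(x;ν,μ) = −B(x;μ,ν)`) whose tension energy over the period obeys `≤ g′·N^d·(L^k)^d∕(L^k)⁶`: `Regular d L N ε (card n·g′ + 220·card n·d³·ε³) k U`.
[folklore] -/
theorem regular_of_tension {L N k : ℕ} (hL : 1 ≤ L) (hN : 1 ≤ N) {ε g' : ℝ} (hε0 : 0 ≤ ε) (hε : ε ≤ 1 / 50)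
    {U : Site d → Fin d → (Matrix n n ℂ)ˣ} (hU : U ∈ sfClass d L N ε k) {B : Site d → Fin d → Fin d → Matrix n n ℂ}
    (hBF : ∀ (x : Site d) (μ ν : Fin d) (h : μ < ν), B x μ ν = flux U (x, ⟨(μ, ν), h⟩))
    (hanti : ∀ (x : Site d) (μ ν : Fin d), B x ν μ = -B x μ ν)
    (hT : ∑ x ∈ periodBox (d := d) (N * L ^ k), ∑ ν : Fin d, nhsNormSq (∑ μ : Fin d, cDstar U μ (fun y => B y μ ν) x)
      ≤ g' * (N : ℝ) ^ d * ((L : ℝ) ^ k) ^ d / ((L : ℝ) ^ k) ^ 6) :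
    Regular d L N ε ((Fintype.card n : ℝ) * g' + 220 * (Fintype.card n : ℝ) * (d : ℝ) ^ 3 * ε ^ 3) k U := by
  have hLk1 : (1 : ℝ) ≤ ((L : ℝ) ^ k) ^ 2 := one_le_pow₀ (one_le_pow₀ (by exact_mod_cast hL))
  have hεk : ε / ((L : ℝ) ^ k) ^ 2 ≤ 1 / 50 := (div_le_self hε0 hLk1).trans hε
  have h := gradFluxSq_le_tension_sfClass hL hN hε0 hεk hU hBF hanti
  refine regular_of_mem_sfClass hU (h.trans ?_)
  have hcard : (0 : ℝ) ≤ (Fintype.card n : ℝ) := Nat.cast_nonneg _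
  have hscale : (0 : ℝ) ≤ (N : ℝ) ^ d * ((L : ℝ) ^ k) ^ d / ((L : ℝ) ^ k) ^ 6 := by positivity
  have h1 := mul_le_mul_of_nonneg_left hT hcard
  have e : ((Fintype.card n : ℝ) * g' + 220 * (Fintype.card n : ℝ) * (d : ℝ) ^ 3 * ε ^ 3) * (N : ℝ) ^ d * ((L : ℝ) ^ k) ^ d / ((L : ℝ) ^ k) ^ 6
      = (Fintype.card n : ℝ) * (g' * (N : ℝ) ^ d * ((L : ℝ) ^ k) ^ d / ((L : ℝ) ^ k) ^ 6)
        + 220 * (Fintype.card n : ℝ) * (d : ℝ) ^ 3 * ε ^ 3 * ((N : ℝ) ^ d * ((L : ℝ) ^ k) ^ d / ((L : ℝ) ^ k) ^ 6) := by ring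
  rw [e]
  linarith

/-- **(H∃)ᴱ FROM (H∃)ᵀ.**  If for every datum `V ∈ dom` and every level `k` SOME minimiser of run `k` over `sfClass d L N ε` has, for its flux form,
tension energy `≤ g′·N^d·(L^k)^d∕(L^k)⁶`, then the energy-class hypothesis (H∃)ᴱ of `NE7Route1EndDockedEnergy` holds with `b = ε` and
`g = card n·g′ + 220·card n·d³·ε³` (`L, N ≥ 1`, `0 ≤ ε ≤ 1∕50`). [folklore] -/
theorem hminE_of_tension {L N : ℕ} (hL : 1 ≤ L) (hN : 1 ≤ N) {ε g' : ℝ} (hε0 : 0 ≤ ε) (hε : ε ≤ 1 / 50)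
    {dom : Set (Site d → Fin d → (Matrix n n ℂ)ˣ)}
    (h : ∀ V ∈ dom, ∀ k : ℕ, ∃ (U : Site d → Fin d → (Matrix n n ℂ)ˣ) (B : Site d → Fin d → Fin d → Matrix n n ℂ),
      IsMinimiser d (sfClass d L N ε) L N k V U ∧
      (∀ (x : Site d) (μ ν : Fin d) (hμν : μ < ν), B x μ ν = flux U (x, ⟨(μ, ν), hμν⟩)) ∧
      (∀ (x : Site d) (μ ν : Fin d), B x ν μ = -B x μ ν) ∧
      ∑ x ∈ periodBox (d := d) (N * L ^ k), ∑ ν : Fin d, nhsNormSq (∑ μ : Fin d, cDstar U μ (fun y => B y μ ν) x)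
        ≤ g' * (N : ℝ) ^ d * ((L : ℝ) ^ k) ^ d / ((L : ℝ) ^ k) ^ 6) :
    ∀ V ∈ dom, ∀ k : ℕ, ∃ U, IsMinimiser d (sfClass d L N ε) L N k V U ∧
      Regular d L N ε ((Fintype.card n : ℝ) * g' + 220 * (Fintype.card n : ℝ) * (d : ℝ) ^ 3 * ε ^ 3) k U := by
  intro V hV k
  obtain ⟨U, B, hmin, hBF, hanti, hT⟩ := h V hV k
  exact ⟨U, hmin, regular_of_tension hL hN hε0 hε hmin.mem.1 hBF hanti hT⟩

/-- **(H∃)ᴱ FROM NON-EMPTINESS AND A UNIVERSAL A-PRIORI TENSION BOUND** (existence of minimisers by compactness, in the regime of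
`MinimalActionExistence.exists_isMinimiser_of_nonempty`: `L ≥ 2`, `0 ≤ ε`, `16·C₀·ε ≤ 3`, `1024(d+1)(d+4)L²ε ≤ 1`; also `ε ≤ 1∕50`, `N ≥ 1`): if every
admissible set is non-empty and EVERY minimiser's flux form has tension energy `≤ g′·N^d·(L^k)^d∕(L^k)⁶` (the flux form quantified universally —
it is unique), then (H∃)ᴱ holds with `g = card n·g′ + 220·card n·d³·ε³`. [folklore] -/
theorem hminE_of_tension_apriori {L N : ℕ} (hL : 2 ≤ L) (hN : 1 ≤ N) {ε g' : ℝ} (hε0 : 0 ≤ ε) (hε : ε ≤ 1 / 50)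
    (hε1 : 16 * C0 d * ε ≤ 3) (hε2 : 1024 * (d + 1) * (d + 4) * (L : ℝ) ^ 2 * ε ≤ 1)
    {dom : Set (Site d → Fin d → (Matrix n n ℂ)ˣ)}
    (hne : ∀ V ∈ dom, ∀ k : ℕ, (admissible (sfClass d L N ε) L k V).Nonempty)
    (hap : ∀ V ∈ dom, ∀ (k : ℕ) (U : Site d → Fin d → (Matrix n n ℂ)ˣ) (B : Site d → Fin d → Fin d → Matrix n n ℂ),
      IsMinimiser d (sfClass d L N ε) L N k V U →
      (∀ (x : Site d) (μ ν : Fin d) (hμν : μ < ν), B x μ ν = flux U (x, ⟨(μ, ν), hμν⟩)) →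
      (∀ (x : Site d) (μ ν : Fin d), B x ν μ = -B x μ ν) →
      ∑ x ∈ periodBox (d := d) (N * L ^ k), ∑ ν : Fin d, nhsNormSq (∑ μ : Fin d, cDstar U μ (fun y => B y μ ν) x)
        ≤ g' * (N : ℝ) ^ d * ((L : ℝ) ^ k) ^ d / ((L : ℝ) ^ k) ^ 6) :
    ∀ V ∈ dom, ∀ k : ℕ, ∃ U, IsMinimiser d (sfClass d L N ε) L N k V U ∧
      Regular d L N ε ((Fintype.card n : ℝ) * g' + 220 * (Fintype.card n : ℝ) * (d : ℝ) ^ 3 * ε ^ 3) k U := by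
  refine hminE_of_tension (by omega) hN hε0 hε fun V hV k => ?_
  obtain ⟨U, hU⟩ := exists_isMinimiser_of_nonempty hL hε0 hε1 hε2 (hne V hV k)
  obtain ⟨B, hBF, hanti⟩ := exists_fluxForm U
  exact ⟨U, B, hU, hBF, hanti, hap V hV k U B hU hBF hanti⟩

end

end Summit.QuantumFields.BalabanUV.T4Continuum.NE7EtaBackgroundTensionClass
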